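import Literature.LinearAlgebra.Matrix.PermanentColumnPerturbation
import Literature.Analysis.Matrix.GramSchmidtNearIdentity
import HarnessLib

/-!
# The planted estimate through an exact Gram–Schmidt unit matrix: the deterministic core

Topic `Analysis/Matrix`; glue between `LinearAlgebra/Matrix/PermanentColumnPerturbation.lean`
(`|Per(Y(1+E)) - Per Y| ≤ Z_η(Y) = perturbSum η Y` for `E` strictly upper triangular with entries
`≤ η`) and `GramSchmidtNearIdentity.lean` (the structure `U = gsUnit B = B · T · diag(‖b*ₖ‖⁻¹)`,
`permanent_submatrix_gsUnit`, `|T - 1| ≤ 8t` under near-orthogonality). Written for the discharge of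
Aaronson–Arkhipov's Thm. 1.3
(`Literature.Computability.QuantumComplexity.gpeSolvableInFBPPRel_NPRel_of_approxBosonSamplingOracle`),
where the hidden column-orthonormal matrix is `U = gsUnit B` for a coin-sampled `B` with planted rows
`X = B_S`: the oracle sees `U_S = X · T · D^{-1/2}` instead of AA13's `X/√m`, and the machine's estimate
`est = q̃ · n! · ∏ ‖b*ₖ‖²` must be compared with `|Per X|²`. The DETERMINISTIC part of that comparison:

* `norm_permanent_submatrix_mul_tMatrix_sub_le` — `|Per(X T) - Per X| ≤ Z_η(X)` once `|T - 1| ≤ η`;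
* `abs_norm_sq_sub_norm_sq_le` — `| |a|² - |b|² | ≤ (2|b| + |a - b|) |a - b|`;
* `norm_sq_permanent_mul_tMatrix_eq` — `|Per(X T)|² = n! · p_S · ∏ ‖b*ₖ‖²` with
  `p_S = |Per(U_S)|²/n!` (`permanent_submatrix_gsUnit`), when no `b*ₖ` vanishes;
* **`abs_est_sub_norm_sq_permanent_le`** — if `|q - p_S| ≤ θ₂` and `|q̃ - q| ≤ q/kη`, then with
  `est = q̃ · n! · ∏ ‖b*ₖ‖²`, `P = |Per X|`, `Z = Z_η(X)`:
  `|est - P²| ≤ (2P + Z) Z + (P² + (2P + Z) Z)/kη + n! ∏ ‖b*ₖ‖² · θ₂ (1 + 1/kη)`.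

All proved.

## References

* S. Aaronson, A. Arkhipov, *The computational complexity of linear optics*, Theory of Computing 9
  (2013) 143–252, proof of Thm. 1.3, eqs. (5.78)–(5.79), (5.89), (5.93)–(5.95) (pp. 193–195).
-/

noncomputable section

namespace Literature.Analysis.Matrix

open Finset InnerProductSpace Literature.LinearAlgebra.Matrix
open scoped _root_.Matrix ComplexConjugate

variable {m n : ℕ}

/-- **The planted block through `T`**: `|Per(X T) - Per X| ≤ Z_η(X)` once the unit upper triangular
`T = tMatrix B` has `|T - 1| ≤ η` (`X = B_S` or any `n × n` matrix). [cite: AaronsonArkhipovToC2013, proof of Thm. 1.3 (pp. 193–195)] -/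
theorem norm_permanent_submatrix_mul_tMatrix_sub_le (B : _root_.Matrix (Fin m) (Fin n) ℂ)
    (X : _root_.Matrix (Fin n) (Fin n) ℂ) {η : ℝ} (hT : ∀ j k, ‖(tMatrix B - 1) j k‖ ≤ η) :
    ‖(X * tMatrix B).permanent - X.permanent‖ ≤ perturbSum η X := by
  have h := norm_permanent_mul_one_add_sub_le X (tMatrix B - 1)
    (fun j k hkj => tMatrix_sub_one_apply_eq_zero B hkj) hT
  rwa [add_sub_cancel] at h

/-- `| ‖a‖² - ‖b‖² | ≤ (2‖b‖ + ‖a - b‖) ‖a - b‖`. [folklore] -/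
theorem abs_norm_sq_sub_norm_sq_le (a b : ℂ) : |‖a‖ ^ 2 - ‖b‖ ^ 2| ≤ (2 * ‖b‖ + ‖a - b‖) * ‖a - b‖ := by
  have h1 : |‖a‖ - ‖b‖| ≤ ‖a - b‖ := abs_norm_sub_norm_le a b
  have h2 : ‖a‖ + ‖b‖ ≤ 2 * ‖b‖ + ‖a - b‖ := by
    have := norm_le_insert' a b; linarith
  rw [sq_sub_sq, abs_mul, abs_of_nonneg (by positivity : 0 ≤ ‖a‖ + ‖b‖)]
  exact mul_le_mul h2 h1 (abs_nonneg _) (by positivity)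

/-- `|Per(X T)|² = n! · p_S · ∏ ‖b*ₖ‖²` with `p_S = |Per(U_S)|²/n!`, `U = gsUnit B`, `X = B_S`, when
no Gram–Schmidt vector vanishes. [cite: AaronsonArkhipovToC2013, proof of Thm. 1.3, eqs. (5.78)–(5.79) (p. 193)] -/
theorem norm_sq_permanent_mul_tMatrix_eq (B : _root_.Matrix (Fin m) (Fin n) ℂ) (S : Fin n → Fin m)
    (h0 : ∀ k, gramSchmidt ℂ (colVec B) k ≠ 0) :
    ‖(B.submatrix S id * tMatrix B).permanent‖ ^ 2 =
      ‖((gsUnit B).submatrix S id).permanent‖ ^ 2 * ∏ k, ‖gramSchmidt ℂ (colVec B) k‖ ^ 2 := by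
  rw [permanent_submatrix_gsUnit, norm_mul, mul_pow, norm_prod, ← Finset.prod_pow, mul_assoc,
    ← Finset.prod_mul_distrib]
  have h1 : ∏ k, (‖((‖gramSchmidt ℂ (colVec B) k‖ : ℂ))⁻¹‖ ^ 2 * ‖gramSchmidt ℂ (colVec B) k‖ ^ 2) = 1 := by
    refine Finset.prod_eq_one fun k _ => ?_
    have hk : ‖gramSchmidt ℂ (colVec B) k‖ ≠ 0 := norm_ne_zero_iff.2 (h0 k)
    rw [norm_inv, Complex.norm_real, Real.norm_of_nonneg (norm_nonneg _), inv_pow,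
      inv_mul_cancel₀ (pow_ne_zero 2 hk)]
  rw [h1, mul_one]

/-- **The deterministic core.** With `X = B_S`, `P = |Per X|`, `Z = Z_η(X) ≥ |Per(X T) - Per X|`,
`W = ∏ ‖b*ₖ‖²`, `p_S = |Per(U_S)|²/n!`: if the oracle's mass `q` has `|q - p_S| ≤ θ₂` and the counter's
`q̃` has `|q̃ - q| ≤ q / kη`, then the estimate `est = q̃ · n! · W` satisfies
`|est - P²| ≤ (2P + Z) Z + (P² + (2P + Z) Z)/kη + n! W θ₂ (1 + 1/kη)`.
[cite: AaronsonArkhipovToC2013, proof of Thm. 1.3, eqs. (5.89), (5.93)–(5.95) (pp. 194–195)] -/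
theorem abs_est_sub_norm_sq_permanent_le (B : _root_.Matrix (Fin m) (Fin n) ℂ) (S : Fin n → Fin m)
    (h0 : ∀ k, gramSchmidt ℂ (colVec B) k ≠ 0) {η Z θ₂ kη q qt : ℝ}
    (hT : ∀ j k, ‖(tMatrix B - 1) j k‖ ≤ η)
    (hZ : perturbSum η (B.submatrix S id) ≤ Z) (hkη : 0 < kη)
    (hq : |q - ‖((gsUnit B).submatrix S id).permanent‖ ^ 2 / n.factorial| ≤ θ₂)
    (hqt : |qt - q| ≤ q / kη) :
    |qt * n.factorial * ∏ k, ‖gramSchmidt ℂ (colVec B) k‖ ^ 2 - ‖(B.submatrix S id).permanent‖ ^ 2| ≤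
      (2 * ‖(B.submatrix S id).permanent‖ + Z) * Z +
        (‖(B.submatrix S id).permanent‖ ^ 2 + (2 * ‖(B.submatrix S id).permanent‖ + Z) * Z) / kη +
        n.factorial * (∏ k, ‖gramSchmidt ℂ (colVec B) k‖ ^ 2) * θ₂ * (1 + 1 / kη) := by
  set X := B.submatrix S id with hX
  set W := ∏ k, ‖gramSchmidt ℂ (colVec B) k‖ ^ 2 with hW
  set P := ‖X.permanent‖ with hP
  set p := ‖((gsUnit B).submatrix S id).permanent‖ ^ 2 / n.factorial with hp
  have hnf : (0 : ℝ) < n.factorial := by exact_mod_cast Nat.factorial_pos n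
  have hWpos : 0 ≤ W := Finset.prod_nonneg fun k _ => sq_nonneg _
  have hθ : 0 ≤ θ₂ := le_trans (abs_nonneg _) hq
  have hp0 : 0 ≤ p := by positivity
  -- `|Per(XT)|² = n! p W`
  have hXT : ‖(X * tMatrix B).permanent‖ ^ 2 = n.factorial * p * W := by
    rw [hX, norm_sq_permanent_mul_tMatrix_eq B S h0, hp, ← hW]
    field_simp
  -- the perturbation step
  have hdiff : ‖(X * tMatrix B).permanent - X.permanent‖ ≤ Z :=
    (norm_permanent_submatrix_mul_tMatrix_sub_le B X hT).trans hZ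
  have hZ0 : 0 ≤ Z := le_trans (norm_nonneg _) hdiff
  have h1 : |‖(X * tMatrix B).permanent‖ ^ 2 - P ^ 2| ≤ (2 * P + Z) * Z := by
    refine (abs_norm_sq_sub_norm_sq_le _ _).trans ?_
    exact mul_le_mul (by linarith) hdiff (norm_nonneg _) (by positivity)
  -- the counting step: `|qt - p| ≤ (p + θ₂)/kη + θ₂`
  have hq' : q ≤ p + θ₂ := by have := (abs_le.1 hq).2; linarith
  have h2 : |qt - p| ≤ (p + θ₂) / kη + θ₂ := by
    have e1 : |qt - p| ≤ |qt - q| + |q - p| := abs_sub_le _ _ _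
    have e2 : q / kη ≤ (p + θ₂) / kη := div_le_div_of_nonneg_right hq' hkη.le
    linarith
  -- `est - |Per(XT)|² = n! W (qt - p)`
  have hest : qt * n.factorial * W - ‖(X * tMatrix B).permanent‖ ^ 2 = n.factorial * W * (qt - p) := by
    rw [hXT]; ring
  have h3 : |qt * n.factorial * W - ‖(X * tMatrix B).permanent‖ ^ 2| ≤ n.factorial * W * ((p + θ₂) / kη + θ₂) := by
    rw [hest, abs_mul, abs_of_nonneg (by positivity : (0 : ℝ) ≤ n.factorial * W)]
    exact mul_le_mul_of_nonneg_left h2 (by positivity)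
  -- `n! W p = |Per(XT)|² ≤ P² + (2P + Z) Z`
  have h4 : n.factorial * W * p ≤ P ^ 2 + (2 * P + Z) * Z := by
    have : n.factorial * W * p = ‖(X * tMatrix B).permanent‖ ^ 2 := by rw [hXT]; ring
    rw [this]
    have := (abs_le.1 h1).2
    linarith
  -- combine
  calc |qt * n.factorial * W - P ^ 2|
      ≤ |qt * n.factorial * W - ‖(X * tMatrix B).permanent‖ ^ 2| + |‖(X * tMatrix B).permanent‖ ^ 2 - P ^ 2| :=
        abs_sub_le _ _ _
    _ ≤ n.factorial * W * ((p + θ₂) / kη + θ₂) + (2 * P + Z) * Z := add_le_add h3 h1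
    _ = (2 * P + Z) * Z + (n.factorial * W * p) / kη + n.factorial * W * θ₂ * (1 + 1 / kη) := by
        field_simp; ring
    _ ≤ (2 * P + Z) * Z + (P ^ 2 + (2 * P + Z) * Z) / kη + n.factorial * W * θ₂ * (1 + 1 / kη) := by
        gcongr

end Literature.Analysis.Matrix
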